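import Summits.CriticalPhenomena.SAWScalingLimit.Theses.SAWCutPointCondensation
import Literature.Probability.RandomPlanarGeometry.BlobTimePartition

/-!
# Submultiplicativity of the blob partition sums (route `SAWCutPointCondensation`)

Closes item `stmt-CriticalPhenomena-7353`: the route decl
`Summit.CriticalPhenomena.SAWScalingLimit.Theses.SAWCutPointCondensation.BlobCountSubmult`,
`b_{n+m}(t) ≤ b_n(t) · b_m(t)` for every blob fugacity `t ∈ [0,1]` and all `n, m`, where
`b_k(t) = Σ_{v ∈ box 2 k} Σ_{q : k-step walk 0 → v in ℤ²} t ^ B(q)` and `B` is the blob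
time (`|q| − #{cut times}`). The route inlines these terms; the tree names them
`Literature.Probability.RandomPlanarGeometry.BlobTime.partitionSum` / `BlobTime.blobTime`
(`BlobTime.partitionSum_eq`, `BlobTime.blobTime_eq` are `rfl`), and everything below is stated in
that vocabulary.

Proof (the concatenation argument of Madras–Slade 1993, §1.2, `c_{n+m} ≤ c_n c_m`, run for the
weight `t ^ B`): split an `(n+m)`-step walk `q` from `0` at time `n` into `q.take n` and the tail
`q.drop n` translated back to the origin (the tree's `SAW.Zd.shiftHom`). This is an injection
into pairs (`SimpleGraph.Walk.ext_getVert`), the pieces end in `box d n`, `box d m` (the tree's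
`SAW.Zd.mem_box_of_walk`), and `B(q.take n) + B(q.drop n) ≤ B(q)` (the tree's
`BlobTime.blobTime_add_le_blobTime_append` with `Walk.append_take_drop_eq`; translation invariance
`BlobTime.blobTime_map`), so `t ^ B(q) ≤ t ^ B(q.take n) · t ^ B(tail)` on `[0,1]` — including
`t = 0` — and the generic `sum_le_mul_sum_of_injOn` gives `b_{n+m} ≤ b_n b_m`
(`sum_pow_blobTime_le_mul`, any dimension `d`; `partitionSum_add_le` is `d = 2`).

Consequences for the provers of the cruxes (as the item asks): the limit form of the connective
constant, `b_n(t)^{1/n} → μ_B(t)` for `t ∈ [0,1]`, is now the one-liner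
`BlobTime.tendsto_partitionSum_rpow ht (BlobCountSubmult.partitionSum_add_le ht)` (the tree's
conditional Fekete statement with its submultiplicativity hypothesis discharged here);
`μ_B(t)ⁿ ≤ b_n(t)`, `4t ≤ μ_B(t) ≤ 4`, `μ_B(0) = μ` are already unconditional in
`BlobTimePartition.lean` (`BlobTime.pow_connectiveConstant_le_partitionSum`,
`BlobTime.four_mul_le_connectiveConstant`, `BlobTime.connectiveConstant_le_four`,
`BlobTime.connectiveConstant_zero`).

References: N. Madras, G. Slade, *The Self-Avoiding Walk* (1993), §1.2 (eq. (1.2.3) and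
Lemma 1.2.2); R. Bauerschmidt, H. Duminil-Copin, J. Goodman, G. Slade, *Lectures on
self-avoiding walks* (2012), §1.2.
-/

namespace Summit.CriticalPhenomena.SAWScalingLimit.Theorems

open Finset SimpleGraph Literature.Probability.LatticeModels
open Literature.Probability.RandomPlanarGeometry

namespace BlobCountSubmult

/-! ### Generic lemmas -/

section General

variable {V : Type*} {G : SimpleGraph V}

/-- Superadditivity of the blob time under splitting a walk at time `n`:
`B(q.take n) + B(q.drop n) ≤ B(q)` (the tree's `blobTime_add_le_blobTime_append` for
`q = (q.take n).append (q.drop n)`). [folklore] -/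
theorem blobTime_take_add_blobTime_drop_le {u v : V} (q : G.Walk u v) (n : ℕ) :
    BlobTime.blobTime (q.take n) + BlobTime.blobTime (q.drop n) ≤ BlobTime.blobTime q := by
  have h := BlobTime.blobTime_add_le_blobTime_append (q.take n) (q.drop n)
  rwa [Walk.append_take_drop_eq] at h

/-- The blob time is invariant under an endpoint cast `Walk.copy`. [folklore] -/
theorem blobTime_copy {u v u' v' : V} (p : G.Walk u v) (hu : u = u') (hv : v = v') :
    BlobTime.blobTime (p.copy hu hv) = BlobTime.blobTime p := by
  subst hu hv
  rfl

/-- Generic domination of a sum by a product of sums along an injection into a product of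
index sets: if `0 ≤ F`, `x ↦ (π₁ x, π₂ x)` is injective on `S` with values in `T ×ˢ U`,
and `F x ≤ F (π₁ x) * F (π₂ x)` on `S`, then `Σ_S F ≤ (Σ_T F) * (Σ_U F)`. [folklore] -/
theorem sum_le_mul_sum_of_injOn {ι : Type*} [DecidableEq ι] (S T U : Finset ι) (F : ι → ℝ)
    (hF : ∀ x, 0 ≤ F x) (π₁ π₂ : ι → ι) (h₁ : ∀ x ∈ S, π₁ x ∈ T)
    (h₂ : ∀ x ∈ S, π₂ x ∈ U) (hinj : Set.InjOn (fun x => (π₁ x, π₂ x)) S)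
    (hle : ∀ x ∈ S, F x ≤ F (π₁ x) * F (π₂ x)) :
    ∑ x ∈ S, F x ≤ (∑ y ∈ T, F y) * ∑ z ∈ U, F z := by
  calc ∑ x ∈ S, F x ≤ ∑ x ∈ S, F (π₁ x) * F (π₂ x) := sum_le_sum hle
    _ = ∑ p ∈ S.image (fun x => (π₁ x, π₂ x)), F p.1 * F p.2 :=
      (sum_image (f := fun p : ι × ι => F p.1 * F p.2) hinj).symm
    _ ≤ ∑ p ∈ T ×ˢ U, F p.1 * F p.2 :=
      sum_le_sum_of_subset_of_nonneg
        (image_subset_iff.2 fun x hx => mem_product.2 ⟨h₁ x hx, h₂ x hx⟩)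
        fun p _ _ => mul_nonneg (hF _) (hF _)
    _ = (∑ y ∈ T, F y) * ∑ z ∈ U, F z := by rw [sum_product, sum_mul_sum]

end General

variable {d : ℕ}

/-! ### The submultiplicativity estimate -/

/-- **`b_{n+m}(t) ≤ b_n(t) · b_m(t)` on `ℤ^d`** for `0 ≤ t ≤ 1`: split an `(n+m)`-step walk
from `0` at time `n` and translate the tail back to the origin — an injection into pairs of
walks under which the weight `t ^ B` is dominated by the product of the weights of the pieces.
(Madras–Slade 1993, §1.2, eq. (1.2.3), for the blob-time weight.) [folklore] -/
theorem sum_pow_blobTime_le_mul (d : ℕ) {t : ℝ} (ht0 : 0 ≤ t) (ht1 : t ≤ 1) (n m : ℕ) :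
    ∑ v ∈ box d (n + m), ∑ q ∈ (zdGraph d).finsetWalkLength (n + m) (0 : Site d) v,
        t ^ BlobTime.blobTime q ≤
      (∑ v ∈ box d n, ∑ q ∈ (zdGraph d).finsetWalkLength n (0 : Site d) v,
        t ^ BlobTime.blobTime q) *
      ∑ v ∈ box d m, ∑ q ∈ (zdGraph d).finsetWalkLength m (0 : Site d) v,
        t ^ BlobTime.blobTime q := by
  -- the weight on the sigma type of walks from the origin, and the sums as sigma sums
  set F : (Σ v : Site d, (zdGraph d).Walk 0 v) → ℝ := fun x => t ^ BlobTime.blobTime x.2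
  have hsig : ∀ ℓ : ℕ,
      ∑ x ∈ (box d ℓ).sigma (fun v => (zdGraph d).finsetWalkLength ℓ (0 : Site d) v), F x =
        ∑ v ∈ box d ℓ, ∑ q ∈ (zdGraph d).finsetWalkLength ℓ (0 : Site d) v,
          t ^ BlobTime.blobTime q :=
    fun ℓ => sum_sigma _ _ _
  rw [← hsig (n + m), ← hsig n, ← hsig m]
  have hF0 : ∀ x, 0 ≤ F x := fun x => pow_nonneg ht0 _
  -- the translation of `ℤ^d` by `-c`, as a graph homomorphism
  have hτ : ∀ c x : Site d, SAW.Zd.shiftHom (-c) x = x + -c := fun c x => rfl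
  have hτinj : ∀ c : Site d, Function.Injective (SAW.Zd.shiftHom (-c)) := fun c =>
    SAW.Zd.shiftHom_injective (-c)
  refine sum_le_mul_sum_of_injOn _ _ _ F hF0
    (fun x => ⟨x.2.getVert n, x.2.take n⟩)
    (fun x => ⟨x.1 + -x.2.getVert n,
      ((x.2.drop n).map (SAW.Zd.shiftHom (-x.2.getVert n))).copy
        ((hτ _ _).trans (add_neg_cancel _)) (hτ _ _)⟩)
    ?_ ?_ ?_ ?_
  · -- the head is an `n`-step walk from `0`, ending in `box d n`
    rintro ⟨v, q⟩ hx
    rw [mem_sigma] at hx ⊢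
    have hq : q.length = n + m := mem_finsetWalkLength_iff.1 hx.2
    have hlen : (q.take n).length = n := by rw [Walk.take_length, hq, min_eq_left (by omega)]
    exact ⟨SAW.Zd.mem_box_of_walk _ hlen.le, mem_finsetWalkLength_iff.2 hlen⟩
  · -- the translated tail is an `m`-step walk from `0`, ending in `box d m`
    rintro ⟨v, q⟩ hx
    rw [mem_sigma] at hx ⊢
    have hq : q.length = n + m := mem_finsetWalkLength_iff.1 hx.2
    have hlen : (((q.drop n).map (SAW.Zd.shiftHom (-q.getVert n))).copy
        ((hτ _ _).trans (add_neg_cancel _)) (hτ _ _)).length = m := by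
      rw [Walk.length_copy, Walk.length_map, Walk.drop_length, hq, Nat.add_sub_cancel_left]
    exact ⟨SAW.Zd.mem_box_of_walk _ hlen.le, mem_finsetWalkLength_iff.2 hlen⟩
  · -- injectivity: a walk is determined by its head and its translated tail
    rintro ⟨v, q⟩ hx ⟨v', q'⟩ hy hxy
    rw [Finset.mem_coe, mem_sigma] at hx hy
    have hq : q.length = n + m := mem_finsetWalkLength_iff.1 hx.2
    have hq' : q'.length = n + m := mem_finsetWalkLength_iff.1 hy.2
    simp only [Prod.mk.injEq] at hxy
    obtain ⟨h1, h2⟩ := hxy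
    have hw : q.getVert n = q'.getVert n := congrArg Sigma.fst h1
    have htake : ∀ i, i ≤ n → q.getVert i = q'.getVert i := fun i hi => by
      have := congrArg (fun z : Σ v : Site d, (zdGraph d).Walk 0 v => z.2.getVert i) h1
      simpa only [Walk.take_getVert, min_eq_right hi] using this
    have hdrop : ∀ i, q.getVert (n + i) = q'.getVert (n + i) := fun i => by
      have := congrArg (fun z : Σ v : Site d, (zdGraph d).Walk 0 v => z.2.getVert i) h2
      simp only [Walk.getVert_copy, Walk.getVert_map, hτ, Walk.drop_getVert, hw] at this
      exact add_right_cancel this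
    have hall : ∀ i, q.getVert i = q'.getVert i := fun i => by
      by_cases hi : i ≤ n
      · exact htake i hi
      · obtain ⟨j, rfl⟩ : ∃ j, i = n + j := ⟨i - n, by omega⟩
        exact hdrop j
    obtain rfl : v = v' := by
      rw [← q.getVert_of_length_le hq.le, ← q'.getVert_of_length_le hq'.le]
      exact hall _
    obtain rfl : q = q' := Walk.ext_getVert hall
    rfl
  · -- termwise domination of the weight: `t ^ B(q) ≤ t ^ B(take) * t ^ B(tail)`
    rintro ⟨v, q⟩ -
    have h3 : BlobTime.blobTime (((q.drop n).map (SAW.Zd.shiftHom (-q.getVert n))).copy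
        ((hτ _ _).trans (add_neg_cancel _)) (hτ _ _)) = BlobTime.blobTime (q.drop n) := by
      rw [blobTime_copy, BlobTime.blobTime_map _ (hτinj _)]
    have key := pow_le_pow_of_le_one ht0 ht1 (blobTime_take_add_blobTime_drop_le q n)
    rw [pow_add, ← h3] at key
    exact key

/-- **Submultiplicativity of the blob partition sums on `ℤ²`**:
`b_{n+m}(t) ≤ b_n(t) · b_m(t)` for `t ∈ [0,1]` (`BlobTime.partitionSum`; the case `d = 2` of
`sum_pow_blobTime_le_mul`). [folklore] -/
theorem partitionSum_add_le {t : ℝ} (ht : t ∈ Set.Icc (0 : ℝ) 1) (n m : ℕ) :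
    BlobTime.partitionSum t (n + m) ≤ BlobTime.partitionSum t n * BlobTime.partitionSum t m :=
  sum_pow_blobTime_le_mul 2 ht.1 ht.2 n m

end BlobCountSubmult

/-- **Item `stmt-CriticalPhenomena-7353` (`BlobCountSubmult`, route `SAWCutPointCondensation`).**
Submultiplicativity of the whole-plane blob partition sums on `ℤ²`:
`b_{n+m}(t) ≤ b_n(t) · b_m(t)` for `t ∈ [0,1]` and all `n, m`. The route decl inlines `b` and
the blob time; it is definitionally `BlobCountSubmult.partitionSum_add_le`
(`BlobTime.partitionSum_eq`, `BlobTime.blobTime_eq` are `rfl`). [folklore] -/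
theorem BlobCountSubmult_proof :
    Summit.CriticalPhenomena.SAWScalingLimit.Theses.SAWCutPointCondensation.BlobCountSubmult := by
  unfold Summit.CriticalPhenomena.SAWScalingLimit.Theses.SAWCutPointCondensation.BlobCountSubmult
  intro t ht n m
  exact BlobCountSubmult.partitionSum_add_le ht n m

end Summit.CriticalPhenomena.SAWScalingLimit.Theorems
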